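import Mathlib.RingTheory.AlgebraicIndependent.TranscendenceBasis
import Mathlib.RingTheory.Localization.Integral
import Mathlib.FieldTheory.IsAlgClosed.Basic
import Literature.NumberTheory.EllipticCurves.CoordinateRingRegular
import Literature.NumberTheory.EllipticCurves.IsogenyDegree
import HarnessLib

/-!
# Silverman, *AEC*, Thm. II.2.4(a) for isogenies: `K̄(E) / φ^* K̄(E')` is finite

D-0014 keeps `Literature/` sorry-free by stating cited results as named facts `def X : Prop`.
This sibling file of `Literature.NumberTheory.EllipticCurves.IsogenyDegree` **proves** the named
fact `WeierstrassCurve.Isogeny.finiteDimensional_pullbackField W W'` vendored there (Silverman,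
*AEC*, Thm. II.2.4(a): for a non-constant map of curves `φ : C₁ → C₂`, `K(C₁)` is a finite
extension of `φ^* K(C₂)`), for the prelude's isogenies `φ : Isogeny W W'` of elliptic curves and
the subfield `φ.pullbackField = K̄(φ^* x', φ^* y') = φ^* K̄(E')` of `K̄(E)`:
`WeierstrassCurve.Isogeny.finiteDimensional_pullbackField_holds`. Consequently Silverman's degree
`Isogeny.deg φ = [K̄(E) : φ^* K̄(E')]` of `IsogenyDegree` is a positive integer
(`Isogeny.deg_pos_holds`).

## The argument

Silverman deduces II.2.4(a) from the facts that function fields of curves are finitely generated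
of transcendence degree one (Hartshorne II.6.8). Here, for the function field
`k(V) = Frac(k[x, y]/(W(x, y)))` of a Weierstrass curve `V` over any field `k`:

* `k(V)` is algebraic over `k(x)` (the coordinate ring is free of rank two over `k[x]`, Mathlib's
  `CoordinateRing.basis`, and a fraction field of an integral extension is algebraic,
  `IsFractionRing.isAlgebraic_iff'`), so `{x}` is a transcendence basis and `trdeg_k k(V) = 1`
  (`Literature.NumberTheory.EllipticCurves.WeierstrassFunctionField.trdeg_eq_one`, via Mathlib's
  `IsTranscendenceBasis.polynomial` and `IsTranscendenceBasis.algebraMap_comp`);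
* hence every transcendental `u ∈ k(V)` is a transcendence basis (Mathlib's matroid of algebraic
  independence, `AlgebraicIndependent.isTranscendenceBasis_of_lift_trdeg_le_of_finite`) and `k(V)`
  is algebraic over `k(u)` (`isAlgebraic_adjoin_of_transcendental`), hence over every intermediate
  field `L ∋ u`, and then finite over `L` because `k(V) = L(x, y)` with `x, y` algebraic
  (`finiteDimensional_of_transcendental_mem`);
* for an isogeny `φ`, `u = φ^* x'` is transcendental over `K̄`
  (`Isogeny.transcendental_pullbackX`): otherwise `u = c ∈ K̄` (`K̄` algebraically closed), so
  `x'(φ P) = c` at every point of agreement of `φ` with its rational representation, i.e. `φ` maps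
  a cofinite subset of the infinite group `E(K̄)` into the finite set of points of `E'(K̄)` with
  `x`-coordinate `c`; but the fibres of `φ` are finite (cosets of `ker φ`).

## References

* [SilvermanAEC2009] J. H. Silverman, *The Arithmetic of Elliptic Curves*, 2nd ed., GTM 106,
  Springer 2009: II.§2, Thm. II.2.4(a) (p. 20), II.§1 (function fields of curves), III.§4 (p. 66,
  `deg φ`).
* R. Hartshorne, *Algebraic Geometry*, GTM 52, Springer 1977, I.6 and II.6.8 (the input Silverman
  cites for II.2.4).
-/

noncomputable section

open scoped Classical
open scoped Polynomial.Bivariate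
open Polynomial

universe u

/-! ## Transcendence degree one: the function field of a Weierstrass curve -/

namespace Literature.NumberTheory.EllipticCurves.WeierstrassFunctionField

variable {k : Type u} [Field k] (V : WeierstrassCurve.Affine k)

/-- The structure map `k[x] → k(V)` is injective (`k[V]` is free over `k[x]` and embeds in its
fraction field). Silverman, *AEC*, II.§1. [folklore] -/
theorem faithfulSMul_polynomial : FaithfulSMul k[X] V.FunctionField := by
  rw [faithfulSMul_iff_algebraMap_injective, IsScalarTower.algebraMap_eq k[X] V.CoordinateRing]
  exact (IsFractionRing.injective V.CoordinateRing V.FunctionField).comp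
    (Literature.NumberTheory.EllipticCurves.WeierstrassCoordinateRing.algebraMap_injective V)

/-- `k(V)` is algebraic over `k[x]` (`k[V]` is integral over `k[x]`, being module-finite, and a
fraction field of an integral extension is algebraic). Silverman, *AEC*, II.§1–2. [folklore] -/
theorem isAlgebraic_polynomial : Algebra.IsAlgebraic k[X] V.FunctionField := by
  haveI : Module.IsTorsionFree k[X] V.FunctionField := by
    rw [Module.isTorsionFree_iff_algebraMap_injective]
    exact (faithfulSMul_iff_algebraMap_injective _ _).mp (faithfulSMul_polynomial V)
  rw [← IsFractionRing.isAlgebraic_iff' k[X] V.CoordinateRing V.FunctionField]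
  exact Algebra.IsIntegral.isAlgebraic

/-- **`{x}` is a transcendence basis of `k(V)` over `k`.** Hartshorne I.6 / Silverman, *AEC*,
II.§1 (function fields of curves have transcendence degree one). [folklore] -/
theorem isTranscendenceBasis_X :
    IsTranscendenceBasis k fun _ : Fin 1 ↦ algebraMap k[X] V.FunctionField X := by
  haveI := faithfulSMul_polynomial V
  haveI := isAlgebraic_polynomial V
  exact (IsTranscendenceBasis.polynomial (ι := Fin 1) (R := k)).algebraMap_comp
    (A := V.FunctionField)

/-- **`trdeg_k k(V) = 1`.** Silverman, *AEC*, II.§1; Hartshorne I.6. [folklore] -/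
theorem trdeg_eq_one : Algebra.trdeg k V.FunctionField = 1 := by
  have := (isTranscendenceBasis_X V).lift_cardinalMk_eq_trdeg
  simp only [Cardinal.mk_fintype, Fintype.card_fin, Nat.cast_one, Cardinal.lift_one] at this
  exact Cardinal.lift_eq_one.mp this.symm

/-- **`k(V)` is algebraic over `k(u)` for every transcendental `u ∈ k(V)`** (a transcendental
element of a transcendence-degree-one extension is a transcendence basis: the exchange property,
Mathlib's matroid of algebraic independence). Silverman, *AEC*, II.§1–2. [folklore] -/
theorem isAlgebraic_adjoin_of_transcendental {u : V.FunctionField} (hu : Transcendental k u) :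
    Algebra.IsAlgebraic (IntermediateField.adjoin k {u}) V.FunctionField := by
  have hind : AlgebraicIndependent k fun _ : Fin 1 ↦ u :=
    (algebraicIndependent_unique_type_iff (ι := Fin 1)).mpr hu
  have hb : IsTranscendenceBasis k fun _ : Fin 1 ↦ u :=
    hind.isTranscendenceBasis_of_lift_trdeg_le_of_finite (by rw [trdeg_eq_one]; simp)
  have := hb.isAlgebraic_field
  rwa [Set.range_const] at this

/-- The structure map `k[x] → k(V)` is `p ↦ p(x)`. [folklore] -/
theorem algebraMap_polynomial_eq_aeval (p : k[X]) :
    algebraMap k[X] V.FunctionField p = aeval (algebraMap k[X] V.FunctionField X) p := by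
  rw [show algebraMap k[X] V.FunctionField X = (IsScalarTower.toAlgHom k k[X] V.FunctionField) X
    from rfl, aeval_algHom_apply, aeval_X_left_apply]
  rfl

/-- The coordinate ring `k[V]` maps into `k(x, y) ⊆ k(V)` (every element is `p(x) + q(x) y`,
Mathlib's `CoordinateRing.exists_smul_basis_eq`). [folklore] -/
theorem algebraMap_mem_adjoin (a : V.CoordinateRing) :
    algebraMap V.CoordinateRing V.FunctionField a ∈
      IntermediateField.adjoin k {algebraMap k[X] V.FunctionField X,
        algebraMap V.CoordinateRing V.FunctionField
          (WeierstrassCurve.Affine.CoordinateRing.mk V Y)} := by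
  set xF := algebraMap k[X] V.FunctionField X with hxF
  set yF := algebraMap V.CoordinateRing V.FunctionField
    (WeierstrassCurve.Affine.CoordinateRing.mk V Y) with hyF
  obtain ⟨p, q, rfl⟩ := WeierstrassCurve.Affine.CoordinateRing.exists_smul_basis_eq a
  have hx : xF ∈ IntermediateField.adjoin k {xF, yF} :=
    IntermediateField.subset_adjoin _ _ (Set.mem_insert _ _)
  have hy : yF ∈ IntermediateField.adjoin k {xF, yF} :=
    IntermediateField.subset_adjoin _ _ (Set.mem_insert_of_mem _ rfl)
  have hp : ∀ p : k[X], algebraMap k[X] V.FunctionField p ∈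
      IntermediateField.adjoin k {xF, yF} := fun p ↦ by
    rw [algebraMap_polynomial_eq_aeval, ← hxF]
    have hle : Algebra.adjoin k {xF} ≤ (IntermediateField.adjoin k {xF, yF}).toSubalgebra :=
      Algebra.adjoin_le (Set.singleton_subset_iff.mpr hx)
    exact hle (aeval_mem_adjoin_singleton k _)
  rw [map_add, Algebra.smul_def, Algebra.smul_def, map_mul, map_mul, map_one, mul_one,
    ← IsScalarTower.algebraMap_apply, ← IsScalarTower.algebraMap_apply]
  exact add_mem (hp p) (mul_mem (hp q) hy)

/-- **`k(V) = k(x, y)`** (as a field, `k(V)` is generated over `k` by the Weierstrass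
coordinates). Silverman, *AEC*, II.§2, III.§3 (`K(E) = K(x, y)`). [folklore] -/
theorem adjoin_X_Y_eq_top :
    IntermediateField.adjoin k {algebraMap k[X] V.FunctionField X,
      algebraMap V.CoordinateRing V.FunctionField
        (WeierstrassCurve.Affine.CoordinateRing.mk V Y)} = ⊤ := by
  rw [eq_top_iff]
  intro z _
  obtain ⟨a, b, -, rfl⟩ := IsFractionRing.div_surjective (A := V.CoordinateRing) z
  exact div_mem (algebraMap_mem_adjoin V a) (algebraMap_mem_adjoin V b)

/-- `k(V) = L(x, y)` for every intermediate field `L` of `k(V)/k`. [folklore] -/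
theorem adjoin_X_Y_eq_top' (L : IntermediateField k V.FunctionField) :
    IntermediateField.adjoin L {algebraMap k[X] V.FunctionField X,
      algebraMap V.CoordinateRing V.FunctionField
        (WeierstrassCurve.Affine.CoordinateRing.mk V Y)} = ⊤ := by
  rw [eq_top_iff]
  intro z _
  have hz : z ∈ IntermediateField.adjoin k {algebraMap k[X] V.FunctionField X,
      algebraMap V.CoordinateRing V.FunctionField
        (WeierstrassCurve.Affine.CoordinateRing.mk V Y)} := by
    rw [adjoin_X_Y_eq_top]; trivial
  exact (IntermediateField.adjoin_le_iff.mpr (IntermediateField.subset_adjoin L _) :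
    IntermediateField.adjoin k _ ≤ (IntermediateField.adjoin L _).restrictScalars k) hz

/-- **If `k(V)` is algebraic over an intermediate field `L`, it is finite over `L`**
(`k(V) = L(x, y)` with `x, y` algebraic over `L`). [folklore] -/
theorem finiteDimensional_of_isAlgebraic (L : IntermediateField k V.FunctionField)
    [Algebra.IsAlgebraic L V.FunctionField] : FiniteDimensional L V.FunctionField := by
  have hfin : FiniteDimensional L (IntermediateField.adjoin L
      {algebraMap k[X] V.FunctionField X, algebraMap V.CoordinateRing V.FunctionField
        (WeierstrassCurve.Affine.CoordinateRing.mk V Y)}) :=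
    IntermediateField.finiteDimensional_adjoin fun x _ ↦
      (Algebra.IsAlgebraic.isAlgebraic (R := L) x).isIntegral
  rw [adjoin_X_Y_eq_top'] at hfin
  exact LinearEquiv.finiteDimensional
    (IntermediateField.topEquiv (F := L) (E := V.FunctionField)).toLinearEquiv

/-- **`k(V)` is finite over every intermediate field containing a transcendental element**
(algebraic over `k(u) ⊆ L` by `isAlgebraic_adjoin_of_transcendental`, then finite by
`finiteDimensional_of_isAlgebraic`). This is the form of *AEC* Thm. II.2.4(a) used for isogenies.
Silverman, *AEC*, Thm. II.2.4(a). [folklore] -/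
theorem finiteDimensional_of_transcendental_mem (L : IntermediateField k V.FunctionField)
    {u : V.FunctionField} (hu : Transcendental k u) (huL : u ∈ L) :
    FiniteDimensional L V.FunctionField := by
  haveI := isAlgebraic_adjoin_of_transcendental V hu
  have hle : IntermediateField.adjoin k {u} ≤ L :=
    IntermediateField.adjoin_le_iff.mpr (Set.singleton_subset_iff.mpr huL)
  letI : Algebra (IntermediateField.adjoin k {u}) L := (IntermediateField.inclusion hle).toAlgebra
  haveI : IsScalarTower (IntermediateField.adjoin k {u}) L V.FunctionField :=
    IsScalarTower.of_algebraMap_eq fun x ↦ rfl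
  haveI : Algebra.IsAlgebraic L V.FunctionField :=
    Algebra.IsAlgebraic.extendScalars (R := IntermediateField.adjoin k {u})
      (IntermediateField.inclusion_injective hle)
  exact finiteDimensional_of_isAlgebraic V L

end Literature.NumberTheory.EllipticCurves.WeierstrassFunctionField

/-! ## `φ^* x'` is transcendental; II.2.4(a) for isogenies -/

namespace WeierstrassCurve

open geomPoints

variable {K : Type u} [Field K] {W W' : WeierstrassCurve K}

/-- The points of `E'(K̄)` with a given `x`-coordinate `c` form a finite set (their
`y`-coordinates are roots of the monic quadratic `W'(c, Y)`). [folklore] -/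
theorem geomPoints.finite_setOf_x_eq (c : AlgebraicClosure K) :
    {Q : W'.geomPoints | ∃ y h, Q = (Affine.Point.some c y h : W'.geomPoints)}.Finite := by
  set q : (AlgebraicClosure K)[X] :=
    (W'.baseChange (AlgebraicClosure K)).toAffine.polynomial.map (evalRingHom c) with hq
  have hq0 : q ≠ 0 :=
    ((Affine.monic_polynomial (W := (W'.baseChange (AlgebraicClosure K)).toAffine)).map _).ne_zero
  refine ((Polynomial.finite_setOf_isRoot hq0).image fun y ↦
    if h : (W'.baseChange (AlgebraicClosure K)).toAffine.Nonsingular c y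
    then (Affine.Point.some c y h : W'.geomPoints) else 0).subset ?_
  rintro Q ⟨y, h, rfl⟩
  refine ⟨y, ?_, by simp [h]⟩
  simp only [Set.mem_setOf_eq, IsRoot.def, hq, map_evalRingHom_eval]
  exact h.1

/-- The fibres of an isogeny are finite (empty, or cosets of the finite kernel).
Silverman, *AEC*, Cor. III.4.9. [folklore] -/
theorem Isogeny.finite_fibre (φ : Isogeny W W') (Q : W'.geomPoints) :
    {P : W.geomPoints | φ P = Q}.Finite := by
  by_cases hne : {P : W.geomPoints | φ P = Q}.Nonempty
  · obtain ⟨P₀, hP₀⟩ := hne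
    refine (φ.finite_ker.image fun T ↦ P₀ + T).subset fun P hP ↦ ⟨P - P₀, ?_, by abel_nf⟩
    simp only [SetLike.mem_coe, AddMonoidHom.mem_ker, map_sub, Isogeny.coe_toAddMonoidHom]
    rw [show φ P = Q from hP, show φ P₀ = Q from hP₀, sub_self]
  · rw [Set.not_nonempty_iff_eq_empty.mp hne]
    exact Set.finite_empty

/-- **`φ^* x'` is transcendental over `K̄`** for an isogeny `φ : E → E'` (`E` elliptic).
Otherwise `φ^* x' = c ∈ K̄` (`K̄` is algebraically closed), so `x'(φ P) = c` at every point of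
agreement of `φ` with its rational representation; thus `φ` maps a cofinite subset of the infinite
group `E(K̄)` into the finite set of points of `E'(K̄)` with `x`-coordinate `c`, contradicting the
finiteness of its fibres. Silverman, *AEC*, II.§2 (a non-constant map gives an injection
`φ^*` of function fields fixing exactly the constants). [folklore] -/
theorem Isogeny.transcendental_pullbackX [W.IsElliptic] (φ : Isogeny W W') :
    Transcendental (AlgebraicClosure K) φ.pullbackX := by
  intro halg
  set r := φ.rationalRep with hr
  have h1 : (minpoly (AlgebraicClosure K) φ.pullbackX).degree = 1 :=
    IsAlgClosed.degree_eq_one_of_irreducible _ (minpoly.irreducible halg.isIntegral)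
  obtain ⟨c, hc⟩ : φ.pullbackX ∈ (algebraMap (AlgebraicClosure K) W.geomFunctionField).range :=
    minpoly.mem_range_of_degree_eq_one _ _ h1
  have hu : φ.pullbackX = W.evalGeneric r.P₁ / W.evalGeneric r.Q₁ := rfl
  have h0 : W.evalGeneric (r.P₁ - MvPolynomial.C c * r.Q₁) = 0 := by
    rw [map_sub, map_mul, evalGeneric_C, hc, hu, div_mul_cancel₀ _ r.evalGeneric_Q₁_ne_zero,
      sub_self]
  have hval : ∀ P : W.geomPoints, AgreesWithRationalMapAt W W' r.P₁ r.Q₁ r.P₂ r.Q₂ φ P →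
      φ P ∈ {Q : W'.geomPoints | ∃ y h, Q = (Affine.Point.some c y h : W'.geomPoints)} := by
    intro P hP
    obtain ⟨hP0, hQ₁, hQ₂, h', e⟩ := agreesWithRationalMapAt_iff.mp hP
    have hc' : MvPolynomial.eval (xy P) r.P₁ / MvPolynomial.eval (xy P) r.Q₁ = c := by
      have := eval_xy_eq_zero_of_evalGeneric_eq_zero h0 hP0
      simp only [map_sub, map_mul, MvPolynomial.eval_C] at this
      rw [div_eq_iff hQ₁]
      linear_combination this
    refine ⟨_, hc' ▸ h', ?_⟩
    rw [e]
    congr 1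
  have hpre : ((⇑φ) ⁻¹'
      {Q : W'.geomPoints | ∃ y h, Q = (Affine.Point.some c y h : W'.geomPoints)}).Finite :=
    (geomPoints.finite_setOf_x_eq (W' := W') c).preimage' fun Q _ ↦ φ.finite_fibre Q
  have hcompl :
      ({P : W.geomPoints | ¬ AgreesWithRationalMapAt W W' r.P₁ r.Q₁ r.P₂ r.Q₂ φ P}ᶜ).Finite :=
    hpre.subset fun P hP ↦ hval P (by simpa using hP)
  have := r.finite.union hcompl
  rw [Set.union_compl_self] at this
  exact Set.infinite_univ this

/-- **Silverman, *AEC*, Thm. II.2.4(a), discharged for isogenies**: `K̄(E)` is a finite extension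
of `φ^* K̄(E') = K̄(φ^* x', φ^* y')` — the named fact
`WeierstrassCurve.Isogeny.finiteDimensional_pullbackField W W'` of `IsogenyDegree` holds.
(`φ^* x' ∈ φ^* K̄(E')` is transcendental, and `K̄(E)` has transcendence degree one.)
[cite: SilvermanAEC2009, Thm. II.2.4(a)] -/
theorem Isogeny.finiteDimensional_pullbackField_holds (W W' : WeierstrassCurve K) :
    Isogeny.finiteDimensional_pullbackField W W' := by
  intro _ _ φ
  exact Literature.NumberTheory.EllipticCurves.WeierstrassFunctionField.finiteDimensional_of_transcendental_mem
    (W.baseChange (AlgebraicClosure K)).toAffine φ.pullbackField φ.transcendental_pullbackX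
    (IntermediateField.subset_adjoin _ _ (Set.mem_insert _ _))

/-- **`deg φ ≥ 1` unconditionally** (`Isogeny.deg_pos` of `IsogenyDegree` fed with
`finiteDimensional_pullbackField_holds`). Silverman, *AEC*, III.§4 (p. 66). [folklore] -/
theorem Isogeny.deg_pos_holds [W.IsElliptic] [W'.IsElliptic] (φ : Isogeny W W') : 0 < φ.deg :=
  φ.deg_pos (Isogeny.finiteDimensional_pullbackField_holds W W')

/-- **`degHom f ≥ 1` for `f ≠ 0` in `Hom_K(E, E')`, unconditionally.** Silverman, *AEC*,
Cor. III.6.3 (iii)–(iv) (positive definiteness of `deg`). [folklore] -/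
theorem degHom_pos_holds [W.IsElliptic] [W'.IsElliptic] {f : W.geomPoints →+ W'.geomPoints}
    (hf : f ∈ homModule W W') (hf0 : f ≠ 0) : 0 < degHom W W' f :=
  degHom_pos (Isogeny.finiteDimensional_pullbackField_holds W W') hf hf0

end WeierstrassCurve
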